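import Summits.SmoothPoincare4.SmoothPoincare4.Theorems.SullivanDualTargetStubStandardEnd
import Summits.SmoothPoincare4.SmoothPoincare4.Theorems.SullivanDualTargetHelperKjRadialKit
import Summits.SmoothPoincare4.SmoothPoincare4.Theorems.SullivanDualTargetHelperQrSegment
import Summits.SmoothPoincare4.SmoothPoincare4.Theorems.SullivanDualTargetHelperLinearizeImmersion
import Literature.Geometry.Symplectic.GromovR4StdModel

/-!
# SmoothPoincare4 / SullivanDual — crux `Target` (stmt-SmoothPoincare4-7823), line `kaehler-jacket`:
# the converse certificate — a chart-form diffeomorphism yields a STAR-COLLARED JACKET (lead c6)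

We prove the registered helper `helper_starJacketOfChartForm`: if `Σ ∖ p` carries a
diffeomorphism `Φ` onto `ℝ⁴` agreeing with the inverted recentred chart near `p`
(`AgreesWithInvertedChartNear p Φ` — for `Σ ≅ S⁴` this is Palais' disc theorem in chart form,
`palais_puncturedSphere_chartForm_holds`; for a general `Σ` it follows from a symplectic form
standard near `p` by the route's named fact `GromovChartForm`), then `(Σ, p)` admits the data
of the folded apex of line `kaehler-jacket` (`StarJacketAt S p` of the Defs file, here spelled
out): a jacket `F` (even a global immersion) standard near `p`, chart radii `μ = r₁/2 < μ' = 3r₁/4`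
about the inner puncture `q := Φ⁻¹ 0`, an isometry `A`, the constant `u ≡ 2 log μ`, and the collar
`Ψ := F`, which on a neighbourhood of the chart sphere `S_μ(q)` IS the conformal-affine map
`A⁻¹ (e_q − c)`.

Construction.  Read `Φ` in the preferred chart of `Σ ∖ p` at `x₀ = Φ⁻¹ 0` (which is the chart of
`Σ` at `q`, `TopologicalSpace.Opens.chartAt_eq`): `f y := Φ (ch⁻¹ (c + y))` is a local
diffeomorphism germ at `0` with `f 0 = 0`, `Df(0) = L` injective.  The QR/polar normalisation
(`helper_qrSegment`, p134744) supplies an isometry `A` with the whole segment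
`(1 − t) id + t (A ∘ L)` invertible, and the linearisation lemma (`helper_linearizeImmersion2`,
p134759, over the log-slow step `helper_slowStep`) an immersion `g` of the chart ball
`‖y‖ < r₄` equal to `A⁻¹` on `‖y‖ ≤ r₁` and to `f` on `‖y‖ ≥ r₃`.  Put `F := g ∘ (e_q − c)` on the
chart ball `‖e_q x − c‖ < r₄` and `F := Φ` elsewhere: the two definitions agree on
`r₃ < ‖e_q x − c‖ < r₄`, so `F` is a smooth immersion everywhere and equals `Φ` off the closed
`r₃`-chart-ball about `q`; a punctured chart-ball at `p` missing that compact ball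
(`exists_radius_avoiding_closedChartBall`, from the landed `stub_standardEnd` file) gives
`AgreesWithInvertedChartNear p F`.  On the `r₁/4`-shell about `S_μ(q)` we are inside the conformal
zone, `F = A⁻¹ (e_q − c)`, and all collar clauses are identities (`e^{u/2} = μ`).

References: R. S. Palais, *Extending diffeomorphisms*, Proc. AMS 11 (1960), Thm. B [Palais1960];
H. Geiges, *An Introduction to Contact Topology* (2008), Lemma 5.2.4 [Geiges2008].
-/

noncomputable section

set_option linter.dupNamespace false

open scoped Manifold ContDiff Topology
open Set Function Filter Metric
open Literature.Geometry.Kaehler (MForm IsSmoothForm IsClosedForm mextDeriv)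
open Literature.Geometry.Symplectic (punctured InPuncturedChartBall stdSymplecticForm inversion
  invertedStdForm IsSymplecticStandardNearPoint AgreesWithInvertedChartNear)
open Literature.Topology.FourManifolds (HomotopySphere)

namespace Summit.SmoothPoincare4.SmoothPoincare4.Theorems.Target.KaehlerJacket

local notation "E4" => EuclideanSpace ℝ (Fin 4)

/-! ## The converse certificate -/

/-- **A chart-form diffeomorphism yields a star-collared jacket (registered helper
`helper_starJacketOfChartForm`).**  If `Σ ∖ p` carries a diffeomorphism `Φ` onto `ℝ⁴` that agrees
with the inverted recentred chart near `p` (as it does when `Σ ≅ S⁴`, by Palais' disc theorem: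
`palais_puncturedSphere_chartForm_holds`), then `(Σ, p)` admits the data of the folded apex of
line `kaehler-jacket`: a jacket `F` (here even a global immersion) standard near `p`, chart radii
about the inner puncture `q := Φ⁻¹ 0`, an isometry `A`, the constant `u ≡ 2 log μ`, and the collar
`Ψ := F`, which on a neighbourhood of the chart sphere `S_μ(q)` IS the conformal-affine map
`A⁻¹ (e_q − c)`: `F` is obtained from `Φ` by linearising its chart germ at `q`
(`helper_linearizeImmersion2`) along the invertible segment from `A ∘ DΦ` to the identity supplied
by the QR normalisation (`helper_qrSegment`), inside a chart ball so small that it misses a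
punctured chart-ball at `p` (`exists_radius_avoiding_closedChartBall`). [folklore] -/
theorem helper_starJacketOfChartForm :
    ∀ (S : HomotopySphere 4) (p : S.carrier) (Φ : (punctured p) ≃ₘ⟮𝓡 4, 𝓡 4⟯ E4),
      AgreesWithInvertedChartNear p Φ →
      ∃ q : S.carrier, q ≠ p ∧
      ∃ (F : punctured p → E4) (μ μ' : ℝ) (A : E4 ≃ₗᵢ[ℝ] E4) (u : E4 → ℝ)
        (Ψ : punctured p → E4) (δ₁ : ℝ),
        (∀ x : punctured p, x.1 ≠ q →
          ContMDiffAt (𝓡 4) 𝓘(ℝ, E4) ∞ F x ∧ Injective (mfderiv (𝓡 4) 𝓘(ℝ, E4) F x)) ∧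
        AgreesWithInvertedChartNear p F ∧
        0 < μ ∧ μ < μ' ∧
        Metric.closedBall (extChartAt (𝓡 4) q q) μ' ⊆ (extChartAt (𝓡 4) q).target ∧
        (∀ y ∈ Metric.closedBall (extChartAt (𝓡 4) q q) μ', (extChartAt (𝓡 4) q).symm y ≠ p) ∧
        ContDiff ℝ ∞ u ∧ 0 < δ₁ ∧
        (∀ x : punctured p, x.1 ∈ (chartAt E4 q).source →
          |‖extChartAt (𝓡 4) q x.1 - extChartAt (𝓡 4) q q‖ - μ| < δ₁ →
          ContMDiffAt (𝓡 4) 𝓘(ℝ, E4) ∞ Ψ x ∧ Injective (mfderiv (𝓡 4) 𝓘(ℝ, E4) Ψ x)) ∧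
        (∀ x y : punctured p, x.1 ∈ (chartAt E4 q).source →
          |‖extChartAt (𝓡 4) q x.1 - extChartAt (𝓡 4) q q‖ - μ| < δ₁ →
          y.1 ∈ (chartAt E4 q).source →
          |‖extChartAt (𝓡 4) q y.1 - extChartAt (𝓡 4) q q‖ - μ| < δ₁ → Ψ x = Ψ y → x = y) ∧
        (∀ x : punctured p, x.1 ∈ (chartAt E4 q).source →
          |‖extChartAt (𝓡 4) q x.1 - extChartAt (𝓡 4) q q‖ - μ| < δ₁ →
          ∀ v w : TangentSpace (𝓡 4) x,
            stdSymplecticForm (mfderiv (𝓡 4) 𝓘(ℝ, E4) Ψ x v) (mfderiv (𝓡 4) 𝓘(ℝ, E4) Ψ x w) =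
              stdSymplecticForm (mfderiv (𝓡 4) 𝓘(ℝ, E4) F x v) (mfderiv (𝓡 4) 𝓘(ℝ, E4) F x w)) ∧
        (∀ x : punctured p, x.1 ∈ (chartAt E4 q).source →
          ‖extChartAt (𝓡 4) q x.1 - extChartAt (𝓡 4) q q‖ = μ →
          Ψ x = Real.exp (u (A.symm (μ⁻¹ • (extChartAt (𝓡 4) q x.1 - extChartAt (𝓡 4) q q))) / 2) •
            A.symm (μ⁻¹ • (extChartAt (𝓡 4) q x.1 - extChartAt (𝓡 4) q q))) ∧
        (∀ x : punctured p, x.1 ∈ (chartAt E4 q).source →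
          |‖extChartAt (𝓡 4) q x.1 - extChartAt (𝓡 4) q q‖ - μ| < δ₁ →
          (‖extChartAt (𝓡 4) q x.1 - extChartAt (𝓡 4) q q‖ < μ ↔
            ‖Ψ x‖ < Real.exp (u (‖Ψ x‖⁻¹ • Ψ x) / 2))) := by
  intro S p Φ hΦ
  classical
  -- the inner puncture `q := Φ⁻¹ 0` and the charts
  set x₀ : punctured p := Φ.symm 0 with hx₀
  set q : S.carrier := x₀.1 with hqdef
  have hq : q ≠ p := Literature.Geometry.Symplectic.mem_punctured.1 x₀.2
  set e := extChartAt (𝓡 4) q with he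
  set c : E4 := e q with hc
  set ch := chartAt E4 x₀ with hch
  have hch_apply : ∀ z : punctured p, ch z = e z.1 := fun z => rfl
  have hch_source : ∀ z : punctured p, z ∈ ch.source ↔ z.1 ∈ (chartAt E4 q).source := fun z => by
    rw [hch, TopologicalSpace.Opens.chartAt_eq, OpenPartialHomeomorph.subtypeRestr_source]
    rfl
  have hx₀src : x₀ ∈ ch.source := mem_chart_source E4 x₀
  have hchx₀ : ch x₀ = c := rfl
  have hesrc : e.source = (chartAt E4 q).source := extChartAt_source (I := 𝓡 4) q
  -- target facts of the chart of `Σ ∖ p` at `x₀`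
  have htgt_src : ∀ y ∈ ch.target, (ch.symm y).1 ∈ (chartAt E4 q).source := fun y hy =>
    (hch_source _).1 (ch.map_target hy)
  have htgt_apply : ∀ y ∈ ch.target, e (ch.symm y).1 = y := fun y hy => by
    rw [← hch_apply]
    exact ch.right_inv hy
  have htgt_esymm : ∀ y ∈ ch.target, e.symm y = (ch.symm y).1 := fun y hy => by
    have h1 : e.symm (e (ch.symm y).1) = (ch.symm y).1 :=
      e.left_inv (by rw [hesrc]; exact htgt_src y hy)
    rwa [htgt_apply y hy] at h1
  have htgt_e : ch.target ⊆ e.target := by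
    intro y hy
    have h : y ∈ (chartAt E4 q).target :=
      OpenPartialHomeomorph.subtypeRestr_target_subset (chartAt E4 q) ⟨x₀⟩ (by
        rw [hch, TopologicalSpace.Opens.chartAt_eq] at hy
        exact hy)
    rw [he, extChartAt_target]
    exact ⟨by simpa using h, mem_range_self _⟩
  -- a closed chart ball inside the target
  obtain ⟨r₄, hr₄pos, hr₄⟩ : ∃ r₄ : ℝ, 0 < r₄ ∧ Metric.closedBall c r₄ ⊆ ch.target := by
    obtain ⟨r, hr, hsub⟩ := Metric.mem_nhds_iff.1 (ch.open_target.mem_nhds (ch.map_source hx₀src))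
    exact ⟨r / 2, half_pos hr, (Metric.closedBall_subset_ball (half_lt_self hr)).trans hsub⟩
  -- the chart germ of `Φ` at `q`, recentred
  set f : E4 → E4 := fun y => Φ (ch.symm (c + y)) with hfdef
  have hf0 : f 0 = 0 := by
    show Φ (ch.symm (c + 0)) = 0
    rw [add_zero, ← hchx₀, ch.left_inv hx₀src, hx₀, Diffeomorph.apply_symm_apply]
  have hmem : ∀ y : E4, ‖y‖ < r₄ → c + y ∈ ch.target := fun y hy =>
    hr₄ (by rw [Metric.mem_closedBall, dist_eq_norm, add_sub_cancel_left]; exact hy.le)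
  have hn : (∞ : WithTop ℕ∞) ≠ 0 := by simp
  have hf_at : ∀ y : E4, ‖y‖ < r₄ → ContDiffAt ℝ ∞ f y ∧
      ∃ L : E4 →L[ℝ] E4, HasFDerivAt f L y ∧ Injective L := fun y hy => by
    have hty := hmem y hy
    have hch_symm : ContMDiffAt 𝓘(ℝ, E4) (𝓡 4) ∞ ch.symm (c + y) :=
      (contMDiffOn_chart_symm (x := x₀)).contMDiffAt (ch.open_target.mem_nhds hty)
    have hΦ' : ContMDiffAt (𝓡 4) 𝓘(ℝ, E4) ∞ Φ (ch.symm (c + y)) := Φ.contMDiff.contMDiffAt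
    have hadd : ContDiff ℝ ∞ (fun y : E4 => c + y) := contDiff_const.add contDiff_id
    refine ⟨contMDiffAt_iff_contDiffAt.1 (hΦ'.comp y (hch_symm.comp y hadd.contMDiff.contMDiffAt)), ?_⟩
    have h1 : HasMFDerivAt 𝓘(ℝ, E4) 𝓘(ℝ, E4) (fun y : E4 => c + y) y (ContinuousLinearMap.id ℝ E4) :=
      ((hasFDerivAt_id y).const_add c).hasMFDerivAt
    have h2 : HasMFDerivAt 𝓘(ℝ, E4) (𝓡 4) ch.symm (c + y)
        (mfderiv 𝓘(ℝ, E4) (𝓡 4) ch.symm (c + y)) :=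
      ((mdifferentiable_chart x₀).mdifferentiableAt_symm hty).hasMFDerivAt
    have h3 : HasMFDerivAt (𝓡 4) 𝓘(ℝ, E4) Φ (ch.symm (c + y))
        (mfderiv (𝓡 4) 𝓘(ℝ, E4) Φ (ch.symm (c + y))) :=
      (Φ.contMDiff.contMDiffAt.mdifferentiableAt (by simp)).hasMFDerivAt
    have h := h3.comp y (h2.comp y h1)
    have hf' := hasMFDerivAt_iff_hasFDerivAt.1 h
    have hsrc : c + y ∈ ch.symm.source := by
      rw [OpenPartialHomeomorph.symm_source]
      exact hty
    have hΦinj : Injective (mfderiv (𝓡 4) 𝓘(ℝ, E4) Φ (ch.symm (c + y))) :=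
      (Φ.mfderivToContinuousLinearEquiv hn (ch.symm (c + y))).injective
    exact ⟨_, hf', fun v w hvw =>
      (mdifferentiable_chart x₀).symm.mfderiv_injective hsrc (hΦinj hvw)⟩
  have hf_imm : ∀ y : E4, ‖y‖ < r₄ → ContDiffAt ℝ ∞ f y ∧ Injective (fderiv ℝ f y) :=
    fun y hy => by
    obtain ⟨hsm, L, hL, hLinj⟩ := hf_at y hy
    refine ⟨hsm, ?_⟩
    rw [hL.fderiv]
    exact hLinj
  obtain ⟨L, hL0, hLinj⟩ := (hf_at 0 (by simpa using hr₄pos)).2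
  -- the QR normalisation and the linearised immersion
  obtain ⟨A, hseg⟩ := helper_qrSegment L hLinj
  obtain ⟨g, r₁, r₃, hr₁pos, hr₁₃, hr₃₄, hg_at, hg_A, hg_f⟩ :=
    helper_linearizeImmersion2 f L A r₄ hr₄pos hf_imm hf0 hL0 hseg
  -- the jacket: `g ∘ (e − c)` on the chart ball of radius `r₄`, `Φ` elsewhere
  set V : Set (punctured p) := {x | x ∈ ch.source ∧ ‖e x.1 - c‖ < r₄} with hV
  set K₃ : Set (punctured p) := {x | x ∈ ch.source ∧ ‖e x.1 - c‖ ≤ r₃} with hK₃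
  set F : punctured p → E4 := fun x => if x ∈ V then g (e x.1 - c) else Φ x with hF
  have hVopen : IsOpen V := by
    have h : IsOpen (ch.source ∩ ch ⁻¹' Metric.ball c r₄) := ch.isOpen_inter_preimage Metric.isOpen_ball
    convert h using 1
    ext x
    simp only [hV, Set.mem_setOf_eq, Set.mem_inter_iff, Set.mem_preimage, Metric.mem_ball,
      dist_eq_norm, hch_apply]
  have hK₃V : K₃ ⊆ V := fun x hx => ⟨hx.1, lt_of_le_of_lt hx.2 hr₃₄⟩
  have hball₃ : Metric.closedBall c r₃ ⊆ e.target :=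
    ((Metric.closedBall_subset_closedBall hr₃₄.le).trans hr₄).trans htgt_e
  have hK₃closed : IsClosed K₃ := by
    have hcpt : IsCompact (e.symm '' Metric.closedBall c r₃) :=
      (isCompact_closedBall c r₃).image_of_continuousOn
        ((continuousOn_extChartAt_symm (I := 𝓡 4) q).mono hball₃)
    have hK' : K₃ = Subtype.val ⁻¹' (e.symm '' Metric.closedBall c r₃) := by
      ext x
      simp only [hK₃, Set.mem_setOf_eq, Set.mem_preimage, Set.mem_image, Metric.mem_closedBall,
        dist_eq_norm, hch_source]
      constructor
      · rintro ⟨hxs, hxn⟩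
        exact ⟨e x.1, hxn, e.left_inv (by rw [hesrc]; exact hxs)⟩
      · rintro ⟨y, hy, hyx⟩
        have hyt : y ∈ e.target := hball₃ (by rwa [Metric.mem_closedBall, dist_eq_norm])
        have hsrc : e.symm y ∈ (chartAt E4 q).source := by
          rw [← hesrc]
          exact e.map_target hyt
        rw [← hyx]
        exact ⟨hsrc, by rw [e.right_inv hyt]; exact hy⟩
    rw [hK']
    exact hcpt.isClosed.preimage continuous_subtype_val
  -- `F = Φ` off `K₃`
  have hFΦ : ∀ x : punctured p, x ∉ K₃ → F x = Φ x := fun x hx => by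
    by_cases hxV : x ∈ V
    · have hgt : r₃ < ‖e x.1 - c‖ := by
        by_contra h
        exact hx ⟨hxV.1, not_lt.1 h⟩
      have h1 : F x = g (e x.1 - c) := if_pos hxV
      rw [h1, hg_f _ hgt.le]
      show Φ (ch.symm (c + (e x.1 - c))) = Φ x
      rw [add_sub_cancel, ← hch_apply, ch.left_inv hxV.1]
    · exact if_neg hxV
  -- `F` on `V`: the chart expression `g ∘ (e − c)`
  have hFV : ∀ x ∈ V, ContMDiffAt (𝓡 4) 𝓘(ℝ, E4) ∞ F x ∧
      Injective (mfderiv (𝓡 4) 𝓘(ℝ, E4) F x) := fun x hx => by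
    have hev : F =ᶠ[𝓝 x] fun z => g (e z.1 - c) :=
      Filter.eventuallyEq_of_mem (hVopen.mem_nhds hx) fun z hz => if_pos hz
    obtain ⟨hgsm, hginj⟩ := hg_at (e x.1 - c) hx.2
    have hsub : ContDiff ℝ ∞ (fun y : E4 => y - c) := contDiff_id.sub contDiff_const
    have hG : ContDiffAt ℝ ∞ (fun y : E4 => g (y - c)) (e x.1) := hgsm.comp (e x.1) hsub.contDiffAt
    have hch_sm : ContMDiffAt (𝓡 4) 𝓘(ℝ, E4) ∞ ch x :=
      (contMDiffOn_chart (x := x₀)).contMDiffAt (ch.open_source.mem_nhds hx.1)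
    have hcomp : (fun z : punctured p => g (e z.1 - c)) = (fun y : E4 => g (y - c)) ∘ ch := rfl
    refine ⟨?_, ?_⟩
    · refine ContMDiffAt.congr_of_eventuallyEq ?_ hev
      rw [hcomp]
      exact (contMDiffAt_iff_contDiffAt.2 hG).comp x hch_sm
    · rw [hev.mfderiv_eq]
      have hGd : HasFDerivAt (fun y : E4 => g (y - c)) (fderiv ℝ g (e x.1 - c)) (e x.1) := by
        have h1 := (hgsm.differentiableAt (by simp)).hasFDerivAt.comp (e x.1)
          ((hasFDerivAt_id (e x.1)).sub_const c)
        rwa [ContinuousLinearMap.comp_id] at h1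
      have hch_d : HasMFDerivAt (𝓡 4) 𝓘(ℝ, E4) ch x (mfderiv (𝓡 4) 𝓘(ℝ, E4) ch x) :=
        ((mdifferentiable_chart x₀).mdifferentiableAt hx.1).hasMFDerivAt
      have hd : HasMFDerivAt (𝓡 4) 𝓘(ℝ, E4) (fun z : punctured p => g (e z.1 - c)) x
          ((fderiv ℝ g (e x.1 - c)).comp (mfderiv (𝓡 4) 𝓘(ℝ, E4) ch x)) := by
        rw [hcomp]
        exact hGd.hasMFDerivAt.comp x hch_d
      rw [hd.mfderiv]
      intro v w hvw
      exact (mdifferentiable_chart x₀).mfderiv_injective hx.1 (hginj hvw)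
  -- `F` is a global immersion
  have hFall : ∀ x : punctured p, ContMDiffAt (𝓡 4) 𝓘(ℝ, E4) ∞ F x ∧
      Injective (mfderiv (𝓡 4) 𝓘(ℝ, E4) F x) := fun x => by
    by_cases hxK : x ∈ K₃
    · exact hFV x (hK₃V hxK)
    · have hev : F =ᶠ[𝓝 x] (Φ : punctured p → E4) :=
        Filter.eventuallyEq_of_mem (hK₃closed.isOpen_compl.mem_nhds hxK) fun z hz => hFΦ z hz
      refine ⟨Φ.contMDiff.contMDiffAt.congr_of_eventuallyEq hev, ?_⟩
      rw [hev.mfderiv_eq]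
      exact (Φ.mfderivToContinuousLinearEquiv hn x).injective
  -- the radii about `q`
  set μ : ℝ := r₁ / 2 with hμ
  set μ' : ℝ := 3 * r₁ / 4 with hμ'
  have hμpos : 0 < μ := by positivity
  have hμμ' : μ < μ' := by rw [hμ, hμ']; linarith
  have hμ'r₄ : μ' < r₄ := by rw [hμ']; linarith
  have hballμ' : Metric.closedBall c μ' ⊆ ch.target :=
    (Metric.closedBall_subset_closedBall hμ'r₄.le).trans hr₄
  -- points of the `r₁/4`-shell about `S_μ(q)` lie in `V`, where `F = A⁻¹ (e − c)`
  have hshellV : ∀ x : punctured p, x.1 ∈ (chartAt E4 q).source →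
      |‖e x.1 - c‖ - μ| < r₁ / 4 → x ∈ V ∧ F x = A.symm (e x.1 - c) := fun x hxs hxa => by
    have hlt : ‖e x.1 - c‖ < r₁ := by
      have := (abs_lt.1 hxa).2
      rw [hμ] at this
      linarith
    have hxV : x ∈ V := ⟨(hch_source x).2 hxs, by linarith⟩
    refine ⟨hxV, ?_⟩
    have h1 : F x = g (e x.1 - c) := if_pos hxV
    rw [h1, hg_A _ hlt.le]
  -- a punctured chart-ball at `p` avoiding `K₃`
  obtain ⟨εΦ, hεΦ, hΦagree⟩ := hΦ
  obtain ⟨ε₀, hε₀, havoidK⟩ :=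
    exists_radius_avoiding_closedChartBall p q r₃ hball₃ (fun y hy => by
      have hyt : y ∈ ch.target := ((Metric.closedBall_subset_closedBall hr₃₄.le).trans hr₄) hy
      rw [htgt_esymm y hyt]
      exact Literature.Geometry.Symplectic.mem_punctured.1 (ch.symm y).2)
  -- assemble
  refine ⟨q, hq, F, μ, μ', A, fun _ => 2 * Real.log μ, F, r₁ / 4, ?_, ?_, hμpos, hμμ',
    hballμ'.trans htgt_e, ?_, contDiff_const, by positivity, ?_, ?_, ?_, ?_, ?_⟩
  · -- jacket: immersion off `q` (indeed everywhere)
    intro x _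
    exact hFall x
  · -- standard near `p`
    refine ⟨min εΦ ε₀, lt_min hεΦ hε₀, fun x hxs hxb => ?_⟩
    have hxb' : extChartAt (𝓡 4) p x.1 ∈ Metric.ball (extChartAt (𝓡 4) p p) εΦ :=
      Metric.ball_subset_ball (min_le_left _ _) hxb
    have hxb₀ : extChartAt (𝓡 4) p x.1 ∈ Metric.ball (extChartAt (𝓡 4) p p) ε₀ :=
      Metric.ball_subset_ball (min_le_right _ _) hxb
    have hxK : x ∉ K₃ := fun hK => havoidK x.1 hxs hxb₀ ⟨(hch_source x).1 hK.1, hK.2⟩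
    rw [hFΦ x hxK]
    exact hΦagree x hxs hxb'
  · -- the closed `μ'`-ball misses `p`
    intro y hy
    rw [htgt_esymm y (hballμ' hy)]
    exact Literature.Geometry.Symplectic.mem_punctured.1 (ch.symm y).2
  · -- `Ψ = F` is a smooth immersion on the shell
    intro x hxs hxa
    exact hFV x (hshellV x hxs hxa).1
  · -- `Ψ = F` is injective on the shell
    intro x y hxs hxa hys hya hxy
    rw [(hshellV x hxs hxa).2, (hshellV y hys hya).2] at hxy
    have h1 : e x.1 - c = e y.1 - c := A.symm.injective hxy
    have h2 : e x.1 = e y.1 := sub_left_injective h1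
    have h3 : x.1 = y.1 := e.injOn (by rw [hesrc]; exact hxs) (by rw [hesrc]; exact hys) h2
    exact Subtype.ext h3
  · -- `Ψ*ω₀ = F*ω₀` (here `Ψ = F`)
    intro x _ _ v w
    rfl
  · -- the star-shaped model on the sphere (`u ≡ 2 log μ`, `e^{u/2} = μ`)
    intro x hxs hxμ
    have hxa : |‖e x.1 - c‖ - μ| < r₁ / 4 := by
      rw [hxμ, sub_self, abs_zero]
      positivity
    rw [(hshellV x hxs hxa).2, map_smul, smul_smul]
    have hexp : Real.exp (2 * Real.log μ / 2) * μ⁻¹ = 1 := by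
      rw [mul_div_cancel_left₀ _ (two_ne_zero), Real.exp_log hμpos, mul_inv_cancel₀ hμpos.ne']
    rw [hexp, one_smul]
  · -- sides: `‖e x − c‖ < μ ↔ ‖F x‖ < e^{u/2} = μ`
    intro x hxs hxa
    rw [(hshellV x hxs hxa).2, LinearIsometryEquiv.norm_map, mul_div_cancel_left₀ _ (two_ne_zero),
      Real.exp_log hμpos]

end Summit.SmoothPoincare4.SmoothPoincare4.Theorems.Target.KaehlerJacket

end
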